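import Mathlib.Analysis.Calculus.ImplicitContDiff
import Mathlib.Topology.Compactness.Compact
import HarnessLib

/-!
# Smooth zero curves of non-degenerate parametrised equations (implicit function theorem, global branch form)

Analysis/Calculus support file (everything proved).  The finite-dimensional "parameter-selection" step of matched
gluing constructions (Corvino–Schoen 2006, §5: at gluing radius `R` the Kerr parameters `θ(R)` are a zero of a
balance map `Φ(R, ·)`, found by a degree argument) needs the zeros to form a SMOOTH curve in `R`.  Degree theory
gives existence only; smoothness follows from non-degeneracy by the implicit function theorem, in the following
branch form (Mathlib's `ContDiffAt.implicitFunction` is the local statement):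

* `contDiffAt_of_implicitZero` — a CONTINUOUS branch of zeros `θ` of a `Cⁿ` equation `Φ (R, θ R) = const` with
  invertible partial derivative `∂_θ Φ` is `Cⁿ` (it coincides near `R` with the implicit function, by the local
  uniqueness clause `ContDiffAt.eventually_apply_eq_iff_implicitFunction`);
* `continuousAt_of_uniqueZero` — a branch of zeros with values in a compact set `K` on which `Φ (R, ·)` has a
  UNIQUE zero is continuous at `R` (every cluster value is a zero; `IsCompact.tendsto_nhds_of_unique_mapClusterPt`);
* `contDiffOn_zeroCurve` — hence, on an open set of parameters, unique non-degenerate zeros in a compact set form a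
  `Cⁿ` curve.

## References

* J. Corvino, R. Schoen, *On the asymptotics for the vacuum Einstein constraint equations*, J. Differential Geom.
  73 (2006) 185–217, §5. [`CorvinoSchoen2006`]
* J. Dieudonné, *Foundations of Modern Analysis* (1969), (10.2.1)–(10.2.3) (implicit functions).
-/

noncomputable section

namespace Literature.Analysis.Calculus

open scoped Topology ContDiff
open Set Filter Function

variable {E₂ : Type*} [NormedAddCommGroup E₂] [NormedSpace ℝ E₂] [CompleteSpace E₂]
  {F : Type*} [NormedAddCommGroup F] [NormedSpace ℝ F] [CompleteSpace F]

/-- **A continuous branch of non-degenerate zeros is as smooth as the equation.**  Let `Φ : ℝ × E₂ → F` be `Cⁿ`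
at `(R, θ R)` (`n ≠ 0`) with invertible partial derivative in the second variable there, let `θ` be continuous
at `R` and satisfy `Φ (R', θ R') = Φ (R, θ R)` for `R'` near `R`.  Then `θ` is `Cⁿ` at `R`: by the uniqueness
clause of the implicit function theorem (`ContDiffAt.eventually_apply_eq_iff_implicitFunction`) `θ` agrees near
`R` with the implicit function, which is `Cⁿ` (`ContDiffAt.contDiffAt_implicitFunction`).
[folklore] -/
theorem contDiffAt_of_implicitZero {Φ : ℝ × E₂ → F} {θ : ℝ → E₂} {R : ℝ} {n : WithTop ℕ∞} (hn : n ≠ 0)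
    (hΦ : ContDiffAt ℝ n Φ (R, θ R))
    (hinv : (fderiv ℝ Φ (R, θ R) ∘L ContinuousLinearMap.inr ℝ ℝ E₂).IsInvertible)
    (hzero : ∀ᶠ R' in 𝓝 R, Φ (R', θ R') = Φ (R, θ R)) (hθ : ContinuousAt θ R) :
    ContDiffAt ℝ n θ R := by
  have hev := hΦ.eventually_apply_eq_iff_implicitFunction hn hinv
  have htend : Tendsto (fun R' ↦ (R', θ R')) (𝓝 R) (𝓝 (R, θ R)) :=
    (continuous_id.continuousAt.prodMk hθ :)
  have h2 := htend.eventually hev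
  have heq : θ =ᶠ[𝓝 R] hΦ.implicitFunction hn hinv := by
    filter_upwards [h2, hzero] with R' h hz
    exact ((h.mp hz).symm :)
  exact (hΦ.contDiffAt_implicitFunction hn hinv).congr_of_eventuallyEq heq

omit [NormedSpace ℝ E₂] [CompleteSpace E₂] [NormedSpace ℝ F] [CompleteSpace F] in
/-- **Unique zeros in a compact set vary continuously.**  Let `K ⊆ E₂` be compact, `Φ` continuous at every
point of `{R} × K`, `θ R' ∈ K` and `Φ (R', θ R') = 0` for `R'` near `R`, and suppose `θ R` is the ONLY zero of
`Φ (R, ·)` in `K`.  Then `θ` is continuous at `R`: every cluster value `x ∈ K` of `θ` at `R` is a zero of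
`Φ (R, ·)` (continuity), hence equals `θ R`, and values in a compact set with a unique cluster value converge
(`IsCompact.tendsto_nhds_of_unique_mapClusterPt`). [folklore] -/
theorem continuousAt_of_uniqueZero {Φ : ℝ × E₂ → F} {θ : ℝ → E₂} {R : ℝ} {K : Set E₂} (hK : IsCompact K)
    (hΦ : ∀ x ∈ K, ContinuousAt Φ (R, x)) (hmem : ∀ᶠ R' in 𝓝 R, θ R' ∈ K)
    (hzero : ∀ᶠ R' in 𝓝 R, Φ (R', θ R') = 0) (huniq : ∀ x ∈ K, Φ (R, x) = 0 → x = θ R) :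
    ContinuousAt θ R := by
  refine hK.tendsto_nhds_of_unique_mapClusterPt hmem fun x hx hcl ↦ huniq x hx ?_
  -- a cluster value `x ∈ K` of `θ` at `R` is a zero of `Φ (R, ·)`
  by_contra hne
  -- continuity at `(R, x)` gives a product neighbourhood on which `Φ ≠ 0`
  have hnbhd : ∀ᶠ p in 𝓝 (R, x), Φ p ≠ 0 := (hΦ x hx).eventually_ne hne
  obtain ⟨A, hA, B, hB, hAB⟩ := mem_nhds_prod_iff.1 hnbhd
  have hfreq : ∃ᶠ R' in 𝓝 R, θ R' ∈ B := (mapClusterPt_iff_frequently.1 hcl) B hB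
  have hev : ∀ᶠ R' in 𝓝 R, R' ∈ A ∧ Φ (R', θ R') = 0 := (eventually_mem_set.2 hA |>.and hzero :)
  obtain ⟨R', hR'B, hR'A, hR'0⟩ := (hfreq.and_eventually hev).exists
  exact hAB (mk_mem_prod hR'A hR'B) hR'0

/-- **Smooth zero curves from unique non-degenerate zeros (the parameter-selection step of matched gluing).**
Let `S ⊆ ℝ` be open (the radii), `K ⊆ E₂` compact (the parameter ball), `Φ : ℝ × E₂ → F` continuous at every
point of `S × K` and `Cⁿ` (`n ≠ 0`) at the points `(R, θ R)`, `R ∈ S`, of a branch of zeros `θ : ℝ → E₂` with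
`θ R ∈ K`, `Φ (R, θ R) = 0`, invertible partial derivative `∂_θ Φ (R, θ R)`, and `θ R` the unique zero of
`Φ (R, ·)` in `K`.  Then `θ` is `Cⁿ` on `S` (`continuousAt_of_uniqueZero` + `contDiffAt_of_implicitZero`).
With `E₂ = F = ℝ¹⁰` this is the smooth dependence of the selected Kerr parameters on the gluing radius once the
balance map is non-degenerate (existence of the zeros being the degree argument of Corvino–Schoen 2006, §5).
[cite: CorvinoSchoen2006, §5] -/
theorem contDiffOn_zeroCurve :
    ∀ {E₂ : Type} [NormedAddCommGroup E₂] [NormedSpace ℝ E₂] [CompleteSpace E₂]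
      {F : Type} [NormedAddCommGroup F] [NormedSpace ℝ F] [CompleteSpace F]
      (Φ : ℝ × E₂ → F) (θ : ℝ → E₂) (S : Set ℝ) (K : Set E₂) (n : WithTop ℕ∞),
      n ≠ 0 → IsOpen S → IsCompact K →
      (∀ R ∈ S, ∀ x ∈ K, ContinuousAt Φ (R, x)) →
      (∀ R ∈ S, θ R ∈ K ∧ Φ (R, θ R) = 0 ∧ ContDiffAt ℝ n Φ (R, θ R) ∧
        (fderiv ℝ Φ (R, θ R) ∘L ContinuousLinearMap.inr ℝ ℝ E₂).IsInvertible ∧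
        ∀ x ∈ K, Φ (R, x) = 0 → x = θ R) →
      ContDiffOn ℝ n θ S := by
  intro E₂ _ _ _ F _ _ _ Φ θ S K n hn hS hK hΦc hθ R hR
  have hSR : ∀ᶠ R' in 𝓝 R, R' ∈ S := hS.mem_nhds hR
  have hmem : ∀ᶠ R' in 𝓝 R, θ R' ∈ K := hSR.mono fun R' h ↦ (hθ R' h).1
  have hzero : ∀ᶠ R' in 𝓝 R, Φ (R', θ R') = 0 := hSR.mono fun R' h ↦ (hθ R' h).2.1
  obtain ⟨-, h0, hcd, hinv, huniq⟩ := hθ R hR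
  have hcont : ContinuousAt θ R := continuousAt_of_uniqueZero hK (hΦc R hR) hmem hzero huniq
  have hzero' : ∀ᶠ R' in 𝓝 R, Φ (R', θ R') = Φ (R, θ R) := hzero.mono fun R' h ↦ by rw [h, h0]
  exact (contDiffAt_of_implicitZero hn hcd hinv hzero' hcont).contDiffWithinAt

end Literature.Analysis.Calculus

end
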